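import Mathlib
import HarnessLib
import Summits.HubbardSuperconductivity.HubbardSuperconductivity.Theorems.KLProgrammeKLRegimeWickBubbleChannelPP
import Summits.HubbardSuperconductivity.HubbardSuperconductivity.Theorems.KLProgrammeKLRegimeWickScaleFlowConservation

/-!
# Route `KLProgramme` — crux K3, ENGINE child gen 5 (stmt-HubbardSuperconductivity-19918 `KLRegimeEngineV14`), stub `stub_engine_step_values`,
# conjunct (E2-v9/v10) at `1 ≤ n`: the particle–particle channel at GENERAL external pair frequencies, for ANY conserving carrier —
# `bubbleSum_pp_pairKernel_of_conserving`

Cell gate-hubbard-kl, seat hubbard-kl-k3c1-p1 (g6), technique «composed-map remainder propagation».  p1 g9's `bubbleSum_pp_pairLabels` (p500935)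
reads the particle–particle channel of the two-line term at the pair labels with BOTH external pairs at the lowest Matsubara frequency `ω₀` and for
the grid carrier `klWickAction … n`.  The continuous (E2) organisation (`klws_wickStep_of_scaleFlow`, p505675) runs the Riccati comparison
`Γ̇ = −Γ·diag ḃ·Γ + X` on the WHOLE product carrier `TorusSite 2 L × MatsubaraIdx M` (the rung couples all internal frequencies), for the REAL-CUTOFF
carrier `𝒲_Λ`.  So the pp identity is needed (a) at general external frequency pairs `x = (k⃗, ω)`, `y = (k⃗′, ω′)` and (b) for a carrier `W` given
only by its structural properties.  This file proves it in that generality — `W : HubbardGrassmann L M` ANY element obeying the four conservation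
selection rules (charge, frequency, spin, momentum; hypotheses `hWq hWf hWs hWp`, discharged for `klWickAction … n` by p1's `…WickConservation` and
for `𝒲_Λ` by `…WickScaleFlowConservation`, p508142):

* §1 selection at the pp leg strings with general external frequency `ω` (`kernel_pp_minus_left/right_of_conserving`,
  `kernel_pp_eq_zero_of_ne_partner_of_conserving` — the partner is `p̄ = (−ω_p, Q − p⃗)` for EVERY external `ω`, since `n(ω) + n(−ω) = −1` —,
  `kernel_pp_eq_zero_of_spin_eq_of_conserving`);
* §2 **`bubbleSum_pp_pairKernel_of_conserving`**: for diagonal lines `contr ℂ Cᵢ = diagContr ℓᵢ`,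
  `Σ_{X,Y,X′,Y′} contr C₂ X Y · contr C₁ X′ Y′ · kernel W 4 (X,X′,Z₂(x),Z₃(x)) · kernel W 4 (Y,Y′,Z₀(y),Z₁(y))
     = −c₄⁻²·Σ_z λ(z)·K_W(Q)(x,z)·K_W(Q)(z,y)`,
  `K_W(Q)(a,b) := 𝒱₄(W)(ψ̂⁺_{(ω_b,k⃗_b)↑}, ψ̂⁺_{(−ω_b,Q−k⃗_b)↓}, ψ̂⁻_{(−ω_a,Q−k⃗_a)↓}, ψ̂⁻_{(ω_a,k⃗_a)↑})` (the label tuple of `klWickPairKernel`),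
  `λ(z) = ℓ₂(p)ℓ₁(p̄) + ℓ₁(p)ℓ₂(p̄)`, `c₄ = 4!(βL²)³`; matrix form `bubbleSum_pp_pairKernel_matrix_of_conserving`;
* §3 instances: `bubbleSum_pp_pairKernel_klWickAction` (the grid carrier at general frequencies, in terms of `klWickPairKernel … n Q`) and
  **`bubbleSum_pp_pairKernel_wickActionR`** (the real-cutoff carrier `𝒲_Λ`): the rung of the within-slice flow reads
  `ḃ_Λ(z) ∝ λ_Λ(z)` with the line pair `(ℓ₁, ℓ₂) = (ẇ_Λ·βL²ĝ_K, (1 − w_Λ)·βL²ĝ_K)` (`…WickScaleFlowLines`, p506794).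

Proofs are p1 g9's with the frequency `ω₀` replaced by a variable and the carrier abstracted; exact identities only; nothing about the model's physics
is asserted.  0 kit.
-/

noncomputable section

namespace Summit.HubbardSuperconductivity.HubbardSuperconductivity.Theorems.KLRegimeWick

set_option linter.dupNamespace false -- summit = problem name (single-conjunct summit), D-0017

open Literature.MathematicalPhysics.QuantumLattice GrassmannAlgebra Finset Matrix
open Literature.Probability.LatticeModels
open Summit.HubbardSuperconductivity.HubbardSuperconductivity.Theorems.TwoPointAssembly
open Summit.HubbardSuperconductivity.HubbardSuperconductivity.Theorems.KLProgrammeLegKernels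
open Summit.HubbardSuperconductivity.HubbardSuperconductivity.Theorems.KLRegimeSplit

section Generic

variable {L M : ℕ} [NeZero L] [NeZero M] (β : ℝ) (W : HubbardGrassmann L M)

/-! ## §1 Selection rules at the pp leg strings, general external frequency -/

omit [NeZero L] [NeZero M] in
/-- **Charge selection, first slot**: with two incoming `ψ̂⁻` legs, a `ψ̂⁻` line end kills the kernel (any charge-conserving `W`). -/
theorem kernel_pp_minus_left_of_conserving
    (hWq : ∀ (m : ℕ) (X : Fin m → HubbardFieldIdx L M), (∑ i, (if (X i).2 = 0 then (1 : ℤ) else -1)) ≠ 0 → kernel ℂ W m X = 0)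
    (p : FreqMomentum L M) (σ : Fin 2) (X' : HubbardFieldIdx L M) (A B : FreqMomentum L M × Fin 2) :
    kernel ℂ W 4 ![((p, σ), 1), X', (A, 1), (B, 1)] = 0 := by
  rcases X' with ⟨q, c⟩
  refine hWq 4 _ ?_
  fin_cases c <;> simp [Fin.sum_univ_four]

omit [NeZero L] [NeZero M] in
/-- **Charge selection, second slot.** -/
theorem kernel_pp_minus_right_of_conserving
    (hWq : ∀ (m : ℕ) (X : Fin m → HubbardFieldIdx L M), (∑ i, (if (X i).2 = 0 then (1 : ℤ) else -1)) ≠ 0 → kernel ℂ W m X = 0)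
    (X : HubbardFieldIdx L M) (p' : FreqMomentum L M) (σ' : Fin 2) (A B : FreqMomentum L M × Fin 2) :
    kernel ℂ W 4 ![X, ((p', σ'), 1), (A, 1), (B, 1)] = 0 := by
  rcases X with ⟨q, c⟩
  refine hWq 4 _ ?_
  fin_cases c <;> simp [Fin.sum_univ_four]

omit [NeZero L] [NeZero M] in
/-- **Momentum + frequency selection at a general external frequency `ω`**: at the incoming pair legs `((−ω, Q−k⃗)↓−, (ω, k⃗)↑−)`, two outgoing
line ends `ψ̂⁺_{pσ}ψ̂⁺_{p′σ′}` carry the kernel only if `p′ = p̄ = (−ω_p, Q − p⃗)` (`n(ω) + n(−ω) = −1` whatever `ω`). -/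
theorem kernel_pp_eq_zero_of_ne_partner_of_conserving
    (hWf : ∀ (m : ℕ) (X : Fin m → HubbardFieldIdx L M),
      (∑ i, (if (X i).2 = 0 then (1 : ℤ) else -1) * matsubaraInt M (X i).1.1.1) ≠ 0 → kernel ℂ W m X = 0)
    (hWp : ∀ (m : ℕ) (X : Fin m → HubbardFieldIdx L M) (j : Fin 2),
      (∑ i, (if (X i).2 = 0 then (1 : ℤ) else -1) • (X i).1.1.2 j) ≠ 0 → kernel ℂ W m X = 0)
    (Q k : TorusSite 2 L) (ω : MatsubaraIdx M) (p p' : FreqMomentum L M) (σ σ' : Fin 2) (h : p' ≠ (p.1.rev, Q - p.2)) :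
    kernel ℂ W 4 ![((p, σ), 0), ((p', σ'), 0), (((ω.rev, Q - k), 1), 1), (((ω, k), 0), 1)] = 0 := by
  by_cases hf : p'.1 = p.1.rev
  · -- the momenta differ in some coordinate
    have hm : p'.2 ≠ Q - p.2 := fun h2 => h (Prod.ext hf h2)
    have : ∃ j : Fin 2, p'.2 j ≠ (Q - p.2) j := by
      by_contra hall
      push Not at hall
      exact hm (funext hall)
    obtain ⟨j, hj⟩ := this
    refine hWp 4 _ j ?_
    simp only [Fin.sum_univ_four, Matrix.cons_val_zero, Matrix.cons_val_one, Matrix.head_cons, Matrix.cons_val_two, Matrix.tail_cons,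
      Matrix.cons_val_three, Fin.isValue, if_true, one_ne_zero, if_false, one_smul, neg_smul, Pi.sub_apply]
    intro h0
    apply hj
    rw [Pi.sub_apply]
    linear_combination h0
  · refine hWf 4 _ ?_
    simp only [Fin.sum_univ_four, Matrix.cons_val_zero, Matrix.cons_val_one, Matrix.head_cons, Matrix.cons_val_two, Matrix.tail_cons,
      Matrix.cons_val_three, Fin.isValue, if_true, one_ne_zero, if_false, one_mul, neg_mul, matsubaraInt_rev]
    intro h0
    apply hf
    apply (matsubaraInt_add_eq_neg_one_iff p.1 p'.1).1
    linarith

omit [NeZero L] [NeZero M] in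
/-- **Spin selection**: with the incoming pair `(↓, ↑)` the outgoing line ends carry opposite spins. -/
theorem kernel_pp_eq_zero_of_spin_eq_of_conserving
    (hWs : ∀ (m : ℕ) (X : Fin m → HubbardFieldIdx L M),
      (∑ i, (if (X i).2 = 0 then (1 : ℤ) else -1) * (if (X i).1.2 = 0 then 1 else 0)) ≠ 0 → kernel ℂ W m X = 0)
    (Q k : TorusSite 2 L) (ω : MatsubaraIdx M) (p p' : FreqMomentum L M) (σ : Fin 2) :
    kernel ℂ W 4 ![((p, σ), 0), ((p', σ), 0), (((ω.rev, Q - k), 1), 1), (((ω, k), 0), 1)] = 0 := by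
  refine hWs 4 _ ?_
  fin_cases σ <;> simp [Fin.sum_univ_four]

/-! ## §2 The pp channel at general external pair frequencies, any conserving carrier -/

omit [NeZero M] in
/-- **`bubbleSum_pp_pairKernel_of_conserving`** — the particle–particle channel sum at the pair labels with GENERAL external frequencies
`x = (k⃗, ω)` (incoming), `y = (k⃗′, ω′)` (outgoing), for diagonal lines `C₁, C₂` (values `ℓ₁, ℓ₂`) and any carrier `W` obeying the four
conservation selection rules:
`Σ contr C₂ X Y · contr C₁ X′ Y′ · kernel W 4 (X, X′, (−ω,Q−k⃗)↓−, (ω,k⃗)↑−) · kernel W 4 (Y, Y′, (ω′,k⃗′)↑+, (−ω′,Q−k⃗′)↓+)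
   = −c₄⁻²·Σ_{z=(p⃗,ν)} λ(z)·K_W(x,z)·K_W(z,y)`, `K_W(a,b) = 𝒱₄(W)` at the `klWickPairKernel` label tuple, `λ(z) = ℓ₂(p)ℓ₁(p̄) + ℓ₁(p)ℓ₂(p̄)`. -/
theorem bubbleSum_pp_pairKernel_of_conserving (hβ : β ≠ 0)
    (hWq : ∀ (m : ℕ) (X : Fin m → HubbardFieldIdx L M), (∑ i, (if (X i).2 = 0 then (1 : ℤ) else -1)) ≠ 0 → kernel ℂ W m X = 0)
    (hWf : ∀ (m : ℕ) (X : Fin m → HubbardFieldIdx L M),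
      (∑ i, (if (X i).2 = 0 then (1 : ℤ) else -1) * matsubaraInt M (X i).1.1.1) ≠ 0 → kernel ℂ W m X = 0)
    (hWs : ∀ (m : ℕ) (X : Fin m → HubbardFieldIdx L M),
      (∑ i, (if (X i).2 = 0 then (1 : ℤ) else -1) * (if (X i).1.2 = 0 then 1 else 0)) ≠ 0 → kernel ℂ W m X = 0)
    (hWp : ∀ (m : ℕ) (X : Fin m → HubbardFieldIdx L M) (j : Fin 2),
      (∑ i, (if (X i).2 = 0 then (1 : ℤ) else -1) • (X i).1.1.2 j) ≠ 0 → kernel ℂ W m X = 0)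
    {C₁ C₂ : Matrix (HubbardFieldIdx L M) (HubbardFieldIdx L M) ℂ} {ℓ₁ ℓ₂ : FreqMomentum L M → ℂ}
    (h₁ : contr ℂ C₁ = diagContr L M ℓ₁) (h₂ : contr ℂ C₂ = diagContr L M ℓ₂) (Q : TorusSite 2 L) (x y : TorusSite 2 L × MatsubaraIdx M) :
    ∑ X, ∑ Y, ∑ X', ∑ Y', contr ℂ C₂ X Y * contr ℂ C₁ X' Y' *
        (kernel ℂ W 4 ![X, X', (((x.2.rev, Q - x.1), 1), 1), (((x.2, x.1), 0), 1)] *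
          kernel ℂ W 4 ![Y, Y', (((y.2, y.1), 0), 0), (((y.2.rev, Q - y.1), 1), 0)]) =
      -((((Nat.factorial 4 : ℝ) * (β * (L : ℝ) ^ 2) ^ 3 : ℝ) : ℂ)⁻¹ ^ 2 *
        ∑ z : TorusSite 2 L × MatsubaraIdx M,
          (ℓ₂ (z.2, z.1) * ℓ₁ (z.2.rev, Q - z.1) + ℓ₁ (z.2, z.1) * ℓ₂ (z.2.rev, Q - z.1)) *
            (vertexFn L M β W 4
                ![(((z.2, z.1), 0), 0), (((z.2.rev, Q - z.1), 1), 0), (((x.2.rev, Q - x.1), 1), 1), (((x.2, x.1), 0), 1)] *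
              vertexFn L M β W 4
                ![(((y.2, y.1), 0), 0), (((y.2.rev, Q - y.1), 1), 0), (((z.2.rev, Q - z.1), 1), 1), (((z.2, z.1), 0), 1)])) := by
  set c : ℂ := (((Nat.factorial 4 : ℝ) * (β * (L : ℝ) ^ 2) ^ 3 : ℝ) : ℂ) with hc
  set Z₂ : HubbardFieldIdx L M := (((x.2.rev, Q - x.1), 1), 1) with hZ₂
  set Z₃ : HubbardFieldIdx L M := (((x.2, x.1), 0), 1) with hZ₃
  set Z₀ : HubbardFieldIdx L M := (((y.2, y.1), 0), 0) with hZ₀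
  set Z₁ : HubbardFieldIdx L M := (((y.2.rev, Q - y.1), 1), 0) with hZ₁
  -- Step 1: both lines are reciprocal pairs read in both orientations
  rw [h₁, h₂]
  simp_rw [mul_assoc, ← Finset.mul_sum]
  rw [sum_diagContr_mul]
  simp_rw [sum_diagContr_mul]
  -- Step 2: charge conservation at the `a`-vertex (incoming legs `ψ̂⁻ψ̂⁻`): only `ψ̂⁺ψ̂⁺` line ends survive
  have hv1 : ∀ (p : FreqMomentum L M) (σ : Fin 2) (X' : HubbardFieldIdx L M), kernel ℂ W 4 ![((p, σ), 1), X', Z₂, Z₃] = 0 :=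
    fun p σ X' => kernel_pp_minus_left_of_conserving W hWq p σ X' _ _
  have hv2 : ∀ (X : HubbardFieldIdx L M) (p' : FreqMomentum L M) (σ' : Fin 2), kernel ℂ W 4 ![X, ((p', σ'), 1), Z₂, Z₃] = 0 :=
    fun X p' σ' => kernel_pp_minus_right_of_conserving W hWq X p' σ' _ _
  simp only [hv1, hv2, zero_mul, mul_zero, sub_zero, zero_sub, Finset.sum_neg_distrib, mul_neg]
  -- Step 3: momentum + frequency conservation: the second line sits at the pair partner `p̄`
  have hstep3 : ∀ (p : FreqMomentum L M) (σ : Fin 2),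
      ∑ p' : FreqMomentum L M, ∑ σ' : Fin 2, ℓ₁ p' * (kernel ℂ W 4 ![((p, σ), 0), ((p', σ'), 0), Z₂, Z₃] *
          kernel ℂ W 4 ![((p, σ), 1), ((p', σ'), 1), Z₀, Z₁]) =
        ∑ σ' : Fin 2, ℓ₁ (p.1.rev, Q - p.2) * (kernel ℂ W 4 ![((p, σ), 0), (((p.1.rev, Q - p.2), σ'), 0), Z₂, Z₃] *
          kernel ℂ W 4 ![((p, σ), 1), (((p.1.rev, Q - p.2), σ'), 1), Z₀, Z₁]) := by
    intro p σ
    refine Finset.sum_eq_single (p.1.rev, Q - p.2) (fun p' _ hp' => ?_) (fun h => absurd (Finset.mem_univ _) h)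
    refine Finset.sum_eq_zero fun σ' _ => ?_
    rw [kernel_pp_eq_zero_of_ne_partner_of_conserving W hWf hWp Q x.1 x.2 p p' σ σ' hp', zero_mul, mul_zero]
  simp only [hstep3]
  -- Step 4: spin conservation: the internal pair carries opposite spins
  have hspin : ∀ (p : FreqMomentum L M) (σ : Fin 2),
      kernel ℂ W 4 ![((p, σ), 0), (((p.1.rev, Q - p.2), σ), 0), Z₂, Z₃] = 0 :=
    fun p σ => kernel_pp_eq_zero_of_spin_eq_of_conserving W hWs Q x.1 x.2 p _ σ
  simp only [Fin.sum_univ_two, hspin, zero_mul, mul_zero, zero_add, add_zero, Fin.isValue]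
  simp only [Finset.sum_const_zero, zero_sub, neg_neg]
  -- Step 5: the `(↓,↑)` assignment is the `(↑,↓)` one at the partner (involution + antisymmetry)
  rw [Finset.sum_add_distrib]
  have hre : ∑ p : FreqMomentum L M, ℓ₂ p * (ℓ₁ (p.1.rev, Q - p.2) *
        (kernel ℂ W 4 ![((p, 1), 0), (((p.1.rev, Q - p.2), 0), 0), Z₂, Z₃] * kernel ℂ W 4 ![((p, 1), 1), (((p.1.rev, Q - p.2), 0), 1), Z₀, Z₁])) =
      ∑ p : FreqMomentum L M, ℓ₂ (p.1.rev, Q - p.2) * (ℓ₁ p *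
        (kernel ℂ W 4 ![((p, 0), 0), (((p.1.rev, Q - p.2), 1), 0), Z₂, Z₃] * kernel ℂ W 4 ![((p, 0), 1), (((p.1.rev, Q - p.2), 1), 1), Z₀, Z₁])) := by
    refine Fintype.sum_bijective (fun p : FreqMomentum L M => ((p.1.rev, Q - p.2) : FreqMomentum L M)) (pairPartner_involutive Q).bijective
      _ _ (fun p => ?_)
    simp only [Fin.rev_rev, sub_sub_cancel, Prod.mk.eta]
    rw [kernel_four_swap01 W ((p, 1), 0), kernel_four_swap01 W ((p, 1), 1)]
    ring
  rw [hre, ← Finset.sum_add_distrib]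
  -- Step 6: read the two surviving kernels as entries of the frequency-resolved pair kernel of `W`
  rw [← Equiv.sum_comp (Equiv.prodComm (MatsubaraIdx M) (TorusSite 2 L)), Finset.mul_sum, ← Finset.sum_neg_distrib]
  refine Finset.sum_congr rfl fun p _ => ?_
  simp only [Equiv.prodComm_apply, Prod.swap, Prod.mk.eta]
  rw [kernel_four_cycle W Z₀ Z₁ (((p.1.rev, Q - p.2), 1), 1) ((p, 0), 1), kernel_four_eq_inv_mul_vertexFn β hβ W,
    kernel_four_eq_inv_mul_vertexFn β hβ W]
  ring

omit [NeZero M] in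
/-- **Matrix form** on the product carrier: the pp channel sum is `−c₄⁻²·(K_W·diagonal λ·K_W)(x, y)` with
`K_W = Matrix.of (a b ↦ 𝒱₄(W)(pair labels))` — the second-order term of the rung resummation, now at EVERY pair of external frequencies (the Riccati
term `Γ·diag ḃ·Γ` of the within-slice flow). -/
theorem bubbleSum_pp_pairKernel_matrix_of_conserving (hβ : β ≠ 0)
    (hWq : ∀ (m : ℕ) (X : Fin m → HubbardFieldIdx L M), (∑ i, (if (X i).2 = 0 then (1 : ℤ) else -1)) ≠ 0 → kernel ℂ W m X = 0)
    (hWf : ∀ (m : ℕ) (X : Fin m → HubbardFieldIdx L M),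
      (∑ i, (if (X i).2 = 0 then (1 : ℤ) else -1) * matsubaraInt M (X i).1.1.1) ≠ 0 → kernel ℂ W m X = 0)
    (hWs : ∀ (m : ℕ) (X : Fin m → HubbardFieldIdx L M),
      (∑ i, (if (X i).2 = 0 then (1 : ℤ) else -1) * (if (X i).1.2 = 0 then 1 else 0)) ≠ 0 → kernel ℂ W m X = 0)
    (hWp : ∀ (m : ℕ) (X : Fin m → HubbardFieldIdx L M) (j : Fin 2),
      (∑ i, (if (X i).2 = 0 then (1 : ℤ) else -1) • (X i).1.1.2 j) ≠ 0 → kernel ℂ W m X = 0)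
    {C₁ C₂ : Matrix (HubbardFieldIdx L M) (HubbardFieldIdx L M) ℂ} {ℓ₁ ℓ₂ : FreqMomentum L M → ℂ}
    (h₁ : contr ℂ C₁ = diagContr L M ℓ₁) (h₂ : contr ℂ C₂ = diagContr L M ℓ₂) (Q : TorusSite 2 L) (x y : TorusSite 2 L × MatsubaraIdx M) :
    ∑ X, ∑ Y, ∑ X', ∑ Y', contr ℂ C₂ X Y * contr ℂ C₁ X' Y' *
        (kernel ℂ W 4 ![X, X', (((x.2.rev, Q - x.1), 1), 1), (((x.2, x.1), 0), 1)] *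
          kernel ℂ W 4 ![Y, Y', (((y.2, y.1), 0), 0), (((y.2.rev, Q - y.1), 1), 0)]) =
      -((((Nat.factorial 4 : ℝ) * (β * (L : ℝ) ^ 2) ^ 3 : ℝ) : ℂ)⁻¹ ^ 2 *
        ((Matrix.of fun a b : TorusSite 2 L × MatsubaraIdx M => vertexFn L M β W 4
              ![(((b.2, b.1), 0), 0), (((b.2.rev, Q - b.1), 1), 0), (((a.2.rev, Q - a.1), 1), 1), (((a.2, a.1), 0), 1)]) *
            Matrix.diagonal (fun z : TorusSite 2 L × MatsubaraIdx M =>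
              ℓ₂ (z.2, z.1) * ℓ₁ (z.2.rev, Q - z.1) + ℓ₁ (z.2, z.1) * ℓ₂ (z.2.rev, Q - z.1)) *
          (Matrix.of fun a b : TorusSite 2 L × MatsubaraIdx M => vertexFn L M β W 4
              ![(((b.2, b.1), 0), 0), (((b.2.rev, Q - b.1), 1), 0), (((a.2.rev, Q - a.1), 1), 1), (((a.2, a.1), 0), 1)])) x y) := by
  rw [bubbleSum_pp_pairKernel_of_conserving β W hβ hWq hWf hWs hWp h₁ h₂ Q x y, Matrix.mul_apply]
  congr 2
  refine Finset.sum_congr rfl fun z _ => ?_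
  rw [Matrix.mul_diagonal, Matrix.of_apply, Matrix.of_apply]
  ring

end Generic

/-! ## §3 Instances: the grid carrier (general frequencies) and the real-cutoff carrier -/

section Instances

variable {L M : ℕ} [NeZero L] [NeZero M] (β U μ : ℝ) (K : TrigPolyC4v)

/-- **Grid carrier at general external frequencies**: p1's `bubbleSum_pp_pairLabels` with `ω₀` replaced by arbitrary `ω, ω′`, in terms of
`klWickPairKernel … n Q`. -/
theorem bubbleSum_pp_pairKernel_klWickAction (hβ : β ≠ 0) {C₁ C₂ : Matrix (HubbardFieldIdx L M) (HubbardFieldIdx L M) ℂ}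
    {ℓ₁ ℓ₂ : FreqMomentum L M → ℂ} (h₁ : contr ℂ C₁ = diagContr L M ℓ₁) (h₂ : contr ℂ C₂ = diagContr L M ℓ₂) (n : ℕ) (Q : TorusSite 2 L)
    (x y : TorusSite 2 L × MatsubaraIdx M) :
    ∑ X, ∑ Y, ∑ X', ∑ Y', contr ℂ C₂ X Y * contr ℂ C₁ X' Y' *
        (kernel ℂ (klWickAction L M β U μ K n) 4 ![X, X', (((x.2.rev, Q - x.1), 1), 1), (((x.2, x.1), 0), 1)] *
          kernel ℂ (klWickAction L M β U μ K n) 4 ![Y, Y', (((y.2, y.1), 0), 0), (((y.2.rev, Q - y.1), 1), 0)]) =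
      -((((Nat.factorial 4 : ℝ) * (β * (L : ℝ) ^ 2) ^ 3 : ℝ) : ℂ)⁻¹ ^ 2 *
        ∑ z : TorusSite 2 L × MatsubaraIdx M,
          (ℓ₂ (z.2, z.1) * ℓ₁ (z.2.rev, Q - z.1) + ℓ₁ (z.2, z.1) * ℓ₂ (z.2.rev, Q - z.1)) *
            (klWickPairKernel L M β U μ K n Q x z * klWickPairKernel L M β U μ K n Q z y)) := by
  simpa only [klWickPairKernel_apply] using
    bubbleSum_pp_pairKernel_of_conserving β (klWickAction L M β U μ K n) hβ
      (fun _ _ h => kernel_klWickAction_eq_zero_of_charge β U μ K n h) (fun _ _ h => kernel_klWickAction_eq_zero_of_freq β U μ K n h)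
      (fun _ _ h => kernel_klWickAction_eq_zero_of_spin β U μ K n h) (fun _ _ j h => kernel_klWickAction_eq_zero_of_momentum β U μ K n j h)
      h₁ h₂ Q x y

/-- **Real-cutoff carrier `𝒲_Λ`**: the pp channel of the within-slice source, at general external frequencies. -/
theorem bubbleSum_pp_pairKernel_wickActionR (hβ : β ≠ 0) {C₁ C₂ : Matrix (HubbardFieldIdx L M) (HubbardFieldIdx L M) ℂ}
    {ℓ₁ ℓ₂ : FreqMomentum L M → ℂ} (h₁ : contr ℂ C₁ = diagContr L M ℓ₁) (h₂ : contr ℂ C₂ = diagContr L M ℓ₂) (Λ : ℝ) (Q : TorusSite 2 L)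
    (x y : TorusSite 2 L × MatsubaraIdx M) :
    ∑ X, ∑ Y, ∑ X', ∑ Y', contr ℂ C₂ X Y * contr ℂ C₁ X' Y' *
        (kernel ℂ (gaussConv ℂ (hubbardCovBelowCT L M β μ 0 K Λ) (hubbardEffectiveActionCT L M β U μ 0 K Λ)) 4
            ![X, X', (((x.2.rev, Q - x.1), 1), 1), (((x.2, x.1), 0), 1)] *
          kernel ℂ (gaussConv ℂ (hubbardCovBelowCT L M β μ 0 K Λ) (hubbardEffectiveActionCT L M β U μ 0 K Λ)) 4
            ![Y, Y', (((y.2, y.1), 0), 0), (((y.2.rev, Q - y.1), 1), 0)]) =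
      -((((Nat.factorial 4 : ℝ) * (β * (L : ℝ) ^ 2) ^ 3 : ℝ) : ℂ)⁻¹ ^ 2 *
        ∑ z : TorusSite 2 L × MatsubaraIdx M,
          (ℓ₂ (z.2, z.1) * ℓ₁ (z.2.rev, Q - z.1) + ℓ₁ (z.2, z.1) * ℓ₂ (z.2.rev, Q - z.1)) *
            (vertexFn L M β (gaussConv ℂ (hubbardCovBelowCT L M β μ 0 K Λ) (hubbardEffectiveActionCT L M β U μ 0 K Λ)) 4
                ![(((z.2, z.1), 0), 0), (((z.2.rev, Q - z.1), 1), 0), (((x.2.rev, Q - x.1), 1), 1), (((x.2, x.1), 0), 1)] *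
              vertexFn L M β (gaussConv ℂ (hubbardCovBelowCT L M β μ 0 K Λ) (hubbardEffectiveActionCT L M β U μ 0 K Λ)) 4
                ![(((y.2, y.1), 0), 0), (((y.2.rev, Q - y.1), 1), 0), (((z.2.rev, Q - z.1), 1), 1), (((z.2, z.1), 0), 1)])) :=
  bubbleSum_pp_pairKernel_of_conserving β _ hβ
    (fun _ _ h => kernel_wickActionR_eq_zero_of_charge β U μ K Λ h) (fun _ _ h => kernel_wickActionR_eq_zero_of_freq β U μ K Λ h)
    (fun _ _ h => kernel_wickActionR_eq_zero_of_spin β U μ K Λ h) (fun _ _ j h => kernel_wickActionR_eq_zero_of_momentum β U μ K Λ j h)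
    h₁ h₂ Q x y

end Instances

end Summit.HubbardSuperconductivity.HubbardSuperconductivity.Theorems.KLRegimeWick

end
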